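import Summits.BirchSwinnertonDyer.Rank1Residual.Supersingular.SharpFlatRankZeroReal
import Literature.NumberTheory.EllipticCurves.ModularCurvePeriodRatio
import Literature.NumberTheory.EllipticCurves.Sprung2017.SharpFlatPAdicLFunctionProofs
import HarnessLib

/-!
# Route `SignedLowerHalves`, crux `SprungLowerHalfAtThree` (item stmt-BirchSwinnertonDyer-19003): the
# registered stub `stub_chromaticDivisibility` is Λ-FREE — a two-way kernel reduction to the corank-zero
# statement «`Sel_{3^∞}(E/ℚ)` finite ⇒ `r_an = 0` and `ord_3 #Ш_an ≤ ord_3 #Ш`», and the stub CLOSED MODULO it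
# (cell `bsd-ssimc`, seat `bsd-ssimc-k3-c5` gen 0; a `--supports … --as helper` file, closes nothing)

PARTITION (cell bsd-ssimc): X8 (A8) — `p = 3` good supersingular, `a_3 = ±3` — at every analytic rank
(crux 5 is typed rank-free); types-the-object-of; closes NONE. THEOREMS ONLY; nothing is booked.

## What this file proves (the planner's TENURE NOTE v2 of `Lines/birth.md`, as theorems)

Stub (B) of the BC3 skeleton (`Cruxes/SprungLowerHalfAtThree/Lines/birth.lean`, REGISTERED) asks, for an X8
pair `(W, 3)` and its real objects `(f, ϖ, L♯, L♭)`: a colour `•`, an element `ξ ∈ Λ = ℤ₃⟦T⟧` whose BARE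
signed datum `⟨ξ, 0, 0⟩` has Kim's Euler-characteristic property (K) — `Sel_{3^∞}(E/ℚ)` finite ⇒
`ξ(0) = u · 3^{ord₃ ∏c_ℓ} · #Sel_{3^∞}(E/ℚ)`, `u ∈ ℤ₃ˣ` — and the divisibility `ι ξ = ϖ · ι(L^• · h)`,
`h ∈ Λ`. Since `SignedDatum` is bare data (the ♯/♭ Selmer groups are not tree objects), (K) constrains ONLY
the constant term of `ξ`. Consequences, for any X8 pair and either colour (both `c_•` are `3`-adic units):
* `chromaticDatum_of_not_finite_selmer` — `Sel_{p^∞}(E/ℚ)` INFINITE ⇒ (B) holds with `ξ = h = 0`;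
* `chromaticDatum_of_constantCoeff_valuation_le` — `Sel` FINITE, `ϖ` `p`-integral, `ϖ·L(0) ≠ 0` and
  `ord_p(ϖ·L(0)) ≤ ord_p ∏c_ℓ + ord_p #Sel` ⇒ (B) (witness `h = p^{ord ∏c}·#Sel/(ϖ L(0))`, `ξ = ϖ h · L`);
* `chromaticDatum_of_missingLowerBoundAt` — hence at analytic rank `0`, (B) FOLLOWS from the Λ-free
  `MissingLowerBoundAt W p` (`ord_p #Ш_an ≤ ord_p #Ш`) via (P•) `L^•(0) = c_•·[0]⁺_f` (a theorem),
  `L(E,1) = [0]⁺_f·Ω⁺_f` and GZK — the CONVERSE of the tree road `missingLowerBoundAt_of_chromaticLowerDivisibility`;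
* `entireLFunction_one_ne_zero_and_missingLowerBoundAt_of_chromaticDatum` — conversely (B) at a pair with
  `Sel_{p^∞}(E/ℚ)` finite forces `L(E,1) ≠ 0` AND `MissingLowerBoundAt W p`;
* `stub_chromaticDivisibility_of_corankZero_inputs` — the registered stub header VERBATIM from GZK,
  `hasEntireLFunction_rat`, the period-ratio unit at `3` (PUBLISHED facts of the support item) and TWO
  Λ-free inputs displayed as binders: (conv₀) «X8 ∧ `Sel_{3^∞}(E/ℚ)` finite ⇒ `r_an = 0`», (low₀) «X8 ∧
  `r_an = 0` ⇒ `MissingLowerBoundAt W 3`»; and `corankZero_inputs_of_stub_chromaticDivisibility` — the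
  stub (with (A)'s objects from modularity) GIVES BACK (conv₀) ∧ (low₀).

UPSHOT: crux 5 as typed = (A: real objects — modularity + period unit + Sprung's theorem, companion file
`SignedLowerHalvesSprungLowerHalfAtThreeSprungPair.lean`) ∧ (conv₀) ∧ (low₀); its clause (B) carries NO
Λ-adic information beyond the constant term — it is equivalent, pair by pair, to the rank-0 `3`-part lower
bound of BSD plus the corank-0 `3`-converse on X8 (the binders of the leaf road
`X8.missingInputAt_of_chromaticLowerDivisibility_of_surj`, nothing more). The intended ♯/♭ Eisenstein
divisibility (Sprung 2012 Main Conj. 7.21 on `char Sel^•(E/ℚ_∞)^∨`) needs the `SharpFlatSelmerDualData`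
interface to be typable. (conv₀), (low₀) remain OPEN class-wide (Sprung 2024 Thm 1.1 is conditional on
Conj. 3.33; CCSS arXiv:1804.10993, Fouquet–Wan arXiv:2107.13726 PRE); nothing here claims them.

References: [Sprung2017] Thm. 1.12, Cor. 4.11; [Sprung2012] Main Conj. 1.3/7.21, Prop. 7.19; [Sprung2024]
Lemmas 5.5–5.9; [GreenbergLNM1716] §4; [GreenbergVatsal2000] Rem. 3.4; [Mazur1978] Cor. 4.1; [Miller2011LMS] Def. 1.1.
-/

set_option autoImplicit false
set_option linter.dupNamespace false

noncomputable section

open scoped Classical MatrixGroups ModularForm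

open CongruenceSubgroup WeierstrassCurve Literature.NumberTheory.EllipticCurves
  Literature.NumberTheory.EllipticCurves.ModularForms
  Literature.NumberTheory.EllipticCurves.Rank1Residual
  Literature.NumberTheory.EllipticCurves.Rank1Residual.Typed
  Literature.NumberTheory.EllipticCurves.Sprung2017
  Summit.BirchSwinnertonDyer.Rank1Residual.Supersingular

namespace Summit.BirchSwinnertonDyer.BirchSwinnertonDyer.Theorems

/-! ### The bare datum: trivial off corank zero, a constant-term inequality at corank zero -/

section Datum
variable (W : WeierstrassCurve ℚ) (p : ℕ) [Fact p.Prime]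

/-- **(B) is vacuous when `Sel_{p^∞}(E/ℚ)` is infinite.** For ANY `ϖ` and ANY `L ∈ Λ`, the pair
`ξ = 0`, `h = 0` satisfies the bare-datum Euler characteristic (its premise `Finite Sel` fails) and
`ι 0 = ϖ · ι(L · 0)` (at an X8 pair of analytic rank `1` this is the actual situation, by GZK).
[cite: Sprung2012, Main Conj. 1.3 (shape only)] -/
theorem chromaticDatum_of_not_finite_selmer (hSel : ¬ Finite (W.selmerGroupPInfty p)) (ϖ : ℚ)
    (L : IwasawaAlgebra p) :
    ∃ ξ : IwasawaAlgebra p, (⟨ξ, 0, 0⟩ : SignedDatum W p).EulerCharacteristic ∧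
      ∃ h : IwasawaAlgebra p, iwasawaToPowerSeries p ξ =
        PowerSeries.C (ϖ : ℚ_[p]) * iwasawaToPowerSeries p (L * h) :=
  ⟨0, fun hfin ↦ absurd hfin hSel, 0, by simp⟩

/-- **At corank zero, (B) is a constant-term inequality.** Let `L ∈ Λ`, `ϖ ∈ ℚ` `p`-integral,
`Sel_{p^∞}(E/ℚ)` finite, `ϖ · L(0) ≠ 0` and `ord_p(ϖ · L(0)) ≤ ord_p ∏c_ℓ + ord_p #Sel_{p^∞}(E/ℚ)`. Then
there are `ξ, h ∈ Λ` with Kim's bare identity `ξ(0) = 1 · p^{ord_p ∏c} · #Sel` and `ι ξ = ϖ · ι(L · h)`: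
`h = p^{ord ∏c}·#Sel / (ϖ L(0)) ∈ ℤ_p` (constant), `ξ = (ϖ h) · L` (`ϖ h ∈ ℤ_p` as `ord_p ϖ ≥ 0`). Pure
algebra in `ℤ_p⟦T⟧`. [cite: Sprung2012, Main Conj. 1.3 (shape only)] -/
theorem chromaticDatum_of_constantCoeff_valuation_le (L : IwasawaAlgebra p) {ϖ : ℚ}
    (hϖ1 : ‖(ϖ : ℚ_[p])‖ ≤ 1) (hfin : Finite (W.selmerGroupPInfty p))
    (ha0 : (ϖ : ℚ_[p]) * ((PowerSeries.constantCoeff L : ℤ_[p]) : ℚ_[p]) ≠ 0)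
    (hval : ((ϖ : ℚ_[p]) * ((PowerSeries.constantCoeff L : ℤ_[p]) : ℚ_[p])).valuation ≤
      (padicValNat p W.tamagawaProduct : ℤ) + padicValNat p (Nat.card (W.selmerGroupPInfty p))) :
    ∃ ξ : IwasawaAlgebra p, (⟨ξ, 0, 0⟩ : SignedDatum W p).EulerCharacteristic ∧
      ∃ h : IwasawaAlgebra p, iwasawaToPowerSeries p ξ =
        PowerSeries.C (ϖ : ℚ_[p]) * iwasawaToPowerSeries p (L * h) := by
  have hpP : p.Prime := Fact.out
  haveI := hfin
  set L0 : ℚ_[p] := ((PowerSeries.constantCoeff L : ℤ_[p]) : ℚ_[p]) with hL0_def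
  set S : ℚ_[p] := (p : ℚ_[p]) ^ (padicValNat p W.tamagawaProduct) *
    (Nat.card (W.selmerGroupPInfty p) : ℚ_[p]) with hS_def
  have hϖ0 : (ϖ : ℚ_[p]) ≠ 0 := fun h0 ↦ ha0 (by rw [h0, zero_mul])
  have hL00 : L0 ≠ 0 := fun h0 ↦ ha0 (by rw [h0, mul_zero])
  have hcard : 0 < Nat.card (W.selmerGroupPInfty p) := Nat.card_pos
  have hpQ : (p : ℚ_[p]) ≠ 0 := by exact_mod_cast hpP.ne_zero
  have hpow0 : (p : ℚ_[p]) ^ (padicValNat p W.tamagawaProduct) ≠ 0 := pow_ne_zero _ hpQ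
  have hcardQ : (Nat.card (W.selmerGroupPInfty p) : ℚ_[p]) ≠ 0 := by exact_mod_cast hcard.ne'
  have hS0 : S ≠ 0 := mul_ne_zero hpow0 hcardQ
  have hvS : S.valuation =
      (padicValNat p W.tamagawaProduct : ℤ) + padicValNat p (Nat.card (W.selmerGroupPInfty p)) := by
    rw [hS_def, Padic.valuation_mul hpow0 hcardQ, Padic.valuation_pow, Padic.valuation_p,
      Padic.valuation_natCast, mul_one]
  have hvϖ : 0 ≤ (ϖ : ℚ_[p]).valuation := (Padic.norm_le_one_iff_val_nonneg _).mp hϖ1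
  have hvL0 : 0 ≤ L0.valuation := valuation_coe_padicInt_nonneg _ hL00
  have hva : ((ϖ : ℚ_[p]) * L0).valuation = (ϖ : ℚ_[p]).valuation + L0.valuation :=
    Padic.valuation_mul hϖ0 hL00
  set h0 : ℚ_[p] := S * ((ϖ : ℚ_[p]) * L0)⁻¹ with hh0_def
  set s : ℚ_[p] := S * L0⁻¹ with hs_def
  have hh0v : 0 ≤ h0.valuation := by
    rw [hh0_def, Padic.valuation_mul hS0 (inv_ne_zero ha0), Padic.valuation_inv, hvS]
    linarith
  have hsv : 0 ≤ s.valuation := by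
    rw [hs_def, Padic.valuation_mul hS0 (inv_ne_zero hL00), Padic.valuation_inv, hvS]
    rw [hva] at hval
    linarith
  have hϖh0 : (ϖ : ℚ_[p]) * h0 = s := by
    rw [hh0_def, hs_def, mul_inv]
    field_simp
  set hZ : ℤ_[p] := ⟨h0, (Padic.norm_le_one_iff_val_nonneg _).mpr hh0v⟩ with hhZ_def
  set sZ : ℤ_[p] := ⟨s, (Padic.norm_le_one_iff_val_nonneg _).mpr hsv⟩ with hsZ_def
  refine ⟨PowerSeries.C sZ * L, ?_, PowerSeries.C hZ, ?_⟩
  · -- (K): `ξ(0) = s · L0 = S = 1 · p^{ord ∏c} · #Sel`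
    intro _
    refine ⟨1, ?_⟩
    rw [map_mul, PowerSeries.constantCoeff_C, PadicInt.coe_mul, Units.val_one, PadicInt.coe_one,
      one_mul]
    change s * L0 = S
    rw [hs_def, inv_mul_cancel_right₀ hL00]
  · -- (MC↓)•: `ι((ϖ h0)·L) = ϖ · ι(L · h0)`
    rw [map_mul, map_mul, PowerSeries.map_C, PowerSeries.map_C]
    change PowerSeries.C s * iwasawaToPowerSeries p L =
      PowerSeries.C (ϖ : ℚ_[p]) * (iwasawaToPowerSeries p L * PowerSeries.C h0)
    rw [← hϖh0, map_mul]
    ring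

end Datum

section RankZero
variable (W : WeierstrassCurve ℚ) [W.IsElliptic] [W.IsGloballyMinimal] (p : ℕ) [Fact p.Prime]

/-- **(B) FROM the Λ-free lower bound, analytic rank `0`** — the converse of the tree road
`missingLowerBoundAt_of_chromaticLowerDivisibility`. Let `p` be odd and good with `E[p]` irreducible,
`L(E,1) ≠ 0`, `f` the newform of `W`, `ϖ` the period ratio (`ϖ·Ω_W = Ω⁺_f`) ASSUMED `p`-integral,
`(L♯, L♭)` any Sprung pair for `a_p(W)`, `•` a colour with `p ∤ c_•`. If `ord_p #Ш_an ≤ ord_p #Ш`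
(`MissingLowerBoundAt W p`) then there are `ξ, h ∈ Λ` with the bare Euler characteristic (K) and
`ι ξ = ϖ · ι(L^• h)`. Chain: GZK ⇒ `E(ℚ)`, `Ш` finite, `#Sel_{p^∞} = #Ш[p^∞]`; `#Ш_an = t·#tors²/∏c`,
`t = L(E,1)/Ω_W = ϖ·[0]⁺_f`, `p ∤ #tors`, so the hypothesis reads `ord_p t ≤ ord_p ∏c + ord_p #Sel`;
`ϖ · L^•(0) = c_• · t` by (P•) (Sprung's table, a theorem); then the previous construction.
[cite: Sprung2017, Cor. 4.11 (table of special values)] [cite: GreenbergLNM1716, §4 p. 103]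
[cite: MazurTateTeitelbaum1986, §I.8 (8.6)] [cite: Miller2011LMS, Def. 1.1] -/
theorem chromaticDatum_of_missingLowerBoundAt
    (hGZK : rank_eq_analyticRank_of_analyticRank_le_one)
    (hp : p ≠ 2) (hgood : W.HasGoodReductionAtPrime p) (hirr : W.HasIrreducibleModPGaloisRep p)
    (hL : W.entireLFunction 1 ≠ 0)
    {N : ℕ} [NeZero N] {f : CuspForm (Gamma0 N) 2} (hf : IsNewformOf W f)
    {ϖ : ℚ} (hϖ : (ϖ : ℝ) * W.realPeriodRat = plusPeriod f) (hϖ1 : ‖(ϖ : ℚ_[p])‖ ≤ 1)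
    {Lsharp Lflat : IwasawaAlgebra p} (hSP : IsSprungPair f p (W.frobeniusTrace p) Lsharp Lflat)
    (c : Chroma) (hc : ¬ (p : ℤ) ∣ chromaticConst p (W.frobeniusTrace p) c)
    (hlow : MissingLowerBoundAt W p) :
    ∃ ξ : IwasawaAlgebra p, (⟨ξ, 0, 0⟩ : SignedDatum W p).EulerCharacteristic ∧
      ∃ h : IwasawaAlgebra p, iwasawaToPowerSeries p ξ =
        PowerSeries.C (ϖ : ℚ_[p]) * iwasawaToPowerSeries p (chromaticL c Lsharp Lflat * h) := by
  have hpP : p.Prime := Fact.out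
  have hr : W.analyticRank = 0 := analyticRank_eq_zero_of_entireLFunction_one_ne_zero W hL
  have hΩpos : 0 < W.realPeriodRat := W.realPeriodRat_pos_holds
  -- GZK bookkeeping: `E(ℚ)`, `Ш` finite; `#Sel_{p^∞} = #Ш[p^∞]`
  have hr0 : W.mordellWeilRank = 0 := (hGZK W (by omega)).1.trans hr
  haveI hfinE : Finite W.toAffine.Point := W.mordellWeilRank_eq_zero_iff_finite.mp hr0
  haveI hfinSha : Finite W.sha := (hGZK W (by omega)).2
  have hSel : Nat.card (W.selmerGroupPInfty p) =
      Nat.card (AddCommGroup.primaryComponent W.sha p) :=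
    W.natCard_selmerGroupPInfty_eq_natCard_primaryComponent_sha p
  have hcardpos : 0 < Nat.card (AddCommGroup.primaryComponent W.sha p) := Nat.card_pos
  have hfin : Finite (W.selmerGroupPInfty p) :=
    Nat.finite_of_card_ne_zero (by rw [hSel]; exact hcardpos.ne')
  have hvSel : padicValNat p (Nat.card (W.selmerGroupPInfty p)) = padicValNat p W.shaOrder := by
    rw [hSel, padicValNat_card_addPrimaryComponent (A := W.sha) p, WeierstrassCurve.shaOrder]
  -- `t = ϖ · [0]⁺_f = L(E,1)/Ω_W`
  set s : ℚ := ratPlusSymbol f 0 with hs_def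
  set t : ℚ := ϖ * s with ht_def
  have hLval : W.entireLFunction 1 = (((s : ℝ) * plusPeriod f : ℝ) : ℂ) := hf.entireLFunction_one_eq
  have ht : W.entireLFunction 1 / (W.realPeriodRat : ℂ) = ((t : ℚ) : ℂ) := by
    rw [hLval, ← hϖ, div_eq_iff (Complex.ofReal_ne_zero.mpr hΩpos.ne'), ht_def]
    push_cast
    ring
  have hs0 : s ≠ 0 := by
    intro h0
    apply hL
    rw [hLval, h0]
    simp
  have hϖ0 : ϖ ≠ 0 := by
    intro h0
    rw [h0, Rat.cast_zero, zero_mul] at hϖ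
    exact (IsNewform0.plusPeriod_pos_holds hf.1 hf.coeffField_eq_bot).ne' hϖ.symm
  have ht0 : t ≠ 0 := mul_ne_zero hϖ0 hs0
  -- the hypothesis in valuations: `ord_p t ≤ ord_p ∏c + ord_p #Ш`
  obtain ⟨q, hq, hqv⟩ := hlow
  have hq' : q = t * (W.torsionOrder : ℚ) ^ 2 / (W.tamagawaProduct : ℚ) := by
    have h2 := shaAn_eq_of_analyticRank_eq_zero W hGZK hr ht
    exact_mod_cast hq.symm.trans h2
  rw [hq', padicValRat_shaAn_witness W p hirr ht0] at hqv
  have hmain : padicValRat p t ≤ (padicValNat p W.tamagawaProduct : ℤ) + padicValNat p W.shaOrder := by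
    linarith
  -- (P•): `ϖ · L^•(0) = c_• · t`
  have hLc := constantCoeff_chromaticL_of_isSprungPair_of_isNewformOf hp hf hgood hSP c
  have hcne : (chromaticConst p (W.frobeniusTrace p) c : ℚ_[p]) ≠ 0 := by
    have : chromaticConst p (W.frobeniusTrace p) c ≠ 0 := fun h0 ↦ hc (by rw [h0]; exact dvd_zero _)
    exact_mod_cast this
  have htQ0 : ((t : ℚ) : ℚ_[p]) ≠ 0 := by exact_mod_cast ht0
  have ha : (ϖ : ℚ_[p]) * ((PowerSeries.constantCoeff (chromaticL c Lsharp Lflat) : ℤ_[p]) : ℚ_[p]) =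
      (chromaticConst p (W.frobeniusTrace p) c : ℚ_[p]) * ((t : ℚ) : ℚ_[p]) := by
    rw [hLc, ht_def]
    push_cast
    ring
  have ha0 : (ϖ : ℚ_[p]) * ((PowerSeries.constantCoeff (chromaticL c Lsharp Lflat) : ℤ_[p]) : ℚ_[p]) ≠ 0 := by
    rw [ha]; exact mul_ne_zero hcne htQ0
  refine chromaticDatum_of_constantCoeff_valuation_le W p (chromaticL c Lsharp Lflat) hϖ1 hfin ha0 ?_
  rw [ha, Padic.valuation_mul hcne htQ0, Padic.valuation_intCast, padicValInt.eq_zero_of_not_dvd hc,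
    Padic.valuation_ratCast, hvSel]
  simp only [Nat.cast_zero, zero_add]
  exact hmain

/-- **(B) at a pair with `Sel_{p^∞}(E/ℚ)` finite FORCES `L(E,1) ≠ 0` and the Λ-free lower bound.**
Same data (`p` odd, good, `E[p]` irreducible; newform `f`, period ratio `ϖ`, Sprung pair, colour `•`
with `p ∤ c_•`); if `Sel_{p^∞}(E/ℚ)` is finite and `ξ, h` satisfy (K) and `ι ξ = ϖ·ι(L^• h)`, then
`ξ(0) = u·p^k·#Sel ≠ 0`, so `L^•(0) ≠ 0`, so `[0]⁺_f ≠ 0`, so `L(E,1) = [0]⁺_f · Ω⁺_f ≠ 0` — the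
corank-`0` converse — and then `MissingLowerBoundAt W p` is the tree road
`missingLowerBoundAt_of_chromaticLowerDivisibility`. Together with `chromaticDatum_of_missingLowerBoundAt`
and `chromaticDatum_of_not_finite_selmer`: clause (B) of crux 5 is EQUIVALENT, pair by pair (for
`p`-integral `ϖ`), to «`Sel_{p^∞}(E/ℚ)` finite ⇒ (`L(E,1) ≠ 0` ∧ `MissingLowerBoundAt W p`)».
[cite: Sprung2017, Cor. 4.11 (table of special values)] [cite: MazurTateTeitelbaum1986, §I.8 (8.6)]
[cite: Miller2011LMS, Def. 1.1] -/
theorem entireLFunction_one_ne_zero_and_missingLowerBoundAt_of_chromaticDatum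
    (hGZK : rank_eq_analyticRank_of_analyticRank_le_one)
    (hp : p ≠ 2) (hgood : W.HasGoodReductionAtPrime p) (hirr : W.HasIrreducibleModPGaloisRep p)
    {N : ℕ} [NeZero N] {f : CuspForm (Gamma0 N) 2} (hf : IsNewformOf W f)
    {ϖ : ℚ} (hϖ : (ϖ : ℝ) * W.realPeriodRat = plusPeriod f)
    {Lsharp Lflat : IwasawaAlgebra p} (hSP : IsSprungPair f p (W.frobeniusTrace p) Lsharp Lflat)
    (c : Chroma) (hc : ¬ (p : ℤ) ∣ chromaticConst p (W.frobeniusTrace p) c)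
    (hfin : Finite (W.selmerGroupPInfty p))
    (ξ : IwasawaAlgebra p) (hK : (⟨ξ, 0, 0⟩ : SignedDatum W p).EulerCharacteristic)
    (hdiv : ∃ h : IwasawaAlgebra p, iwasawaToPowerSeries p ξ =
      PowerSeries.C (ϖ : ℚ_[p]) * iwasawaToPowerSeries p (chromaticL c Lsharp Lflat * h)) :
    W.entireLFunction 1 ≠ 0 ∧ MissingLowerBoundAt W p := by
  have hpP : p.Prime := Fact.out
  haveI := hfin
  -- (K) with `Sel` finite: `ξ(0) ≠ 0`
  obtain ⟨u, hu⟩ := hK hfin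
  have hcard : 0 < Nat.card (W.selmerGroupPInfty p) := Nat.card_pos
  have hξ0 : ((PowerSeries.constantCoeff ξ : ℤ_[p]) : ℚ_[p]) ≠ 0 := by
    rw [hu]
    refine mul_ne_zero (mul_ne_zero (coe_units_ne_zero p u) (pow_ne_zero _ ?_)) ?_
    · exact_mod_cast hpP.ne_zero
    · exact_mod_cast hcard.ne'
  -- (MC↓)• and (P•): `ξ(0) = ϖ · c_• · [0]⁺_f · h(0)`, so `[0]⁺_f ≠ 0`
  obtain ⟨h, hιξ⟩ := hdiv
  have hLc := constantCoeff_chromaticL_of_isSprungPair_of_isNewformOf hp hf hgood hSP c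
  have hcc := congrArg PowerSeries.constantCoeff hιξ
  rw [constantCoeff_iwasawaToPowerSeries, map_mul, PowerSeries.constantCoeff_C,
    constantCoeff_iwasawaToPowerSeries, map_mul, PadicInt.coe_mul, hLc] at hcc
  have hs0 : ratPlusSymbol f 0 ≠ 0 := by
    intro h0
    apply hξ0
    rw [hcc, h0]
    simp
  have hL : W.entireLFunction 1 ≠ 0 := by
    rw [hf.entireLFunction_one_eq]
    have hΩ : 0 < plusPeriod f := IsNewform0.plusPeriod_pos_holds hf.1 hf.coeffField_eq_bot
    have : ((ratPlusSymbol f 0 : ℚ) : ℝ) * plusPeriod f ≠ 0 :=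
      mul_ne_zero (by exact_mod_cast hs0) hΩ.ne'
    exact_mod_cast this
  exact ⟨hL, missingLowerBoundAt_of_chromaticLowerDivisibility W p hGZK hp hgood hirr hL hf hϖ hSP c hc
    ξ hK ⟨h, hιξ⟩⟩

end RankZero

section X8

/-- **On X8 the period ratio is a `3`-adic unit** (from the period-ratio fact at `3`, `hper`:
`Ω_W = u·Ω⁺_f`, `|u|_3 = 1`; the ratio `ϖ` with `ϖ·Ω_W = Ω⁺_f` is `u⁻¹` since `Ω⁺_f > 0`).
CONDITIONAL on `hper`. [cite: GreenbergVatsal2000, §3 Remark 3.4] [cite: Mazur1978, Cor. 4.1] -/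
theorem X8_norm_periodRatio_eq_one (hper : realPeriodRat_eq_unit_mul_plusPeriod_three)
    (W : WeierstrassCurve ℚ) [W.IsElliptic] [W.IsGloballyMinimal] (p : ℕ) [Fact p.Prime]
    (hX : ClassX8 W p) {N : ℕ} [NeZero N] {f : CuspForm (Gamma0 N) 2} (hf : IsNewformOf W f)
    {ϖ : ℚ} (hϖ : (ϖ : ℝ) * W.realPeriodRat = plusPeriod f) : ‖(ϖ : ℚ_[p])‖ = 1 := by
  have hp3 : p = 3 := hX.1
  subst hp3
  obtain ⟨u, hu1, hΩ⟩ := hper W hX.2.1.1 (ClassX8.irr W 3 hX) f hf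
  have hΩf : 0 < plusPeriod f := IsNewform0.plusPeriod_pos_holds hf.1 hf.coeffField_eq_bot
  have hϖu : (ϖ : ℝ) * u = 1 := by
    rw [hΩ, ← mul_assoc] at hϖ
    exact (mul_eq_right₀ hΩf.ne').mp hϖ
  have hϖu' : ϖ * u = 1 := by exact_mod_cast hϖu
  have : (ϖ : ℚ_[3]) * (u : ℚ_[3]) = 1 := by exact_mod_cast hϖu'
  have hn := congrArg (‖·‖) this
  simp only [norm_mul, hu1, mul_one, norm_one] at hn
  exact hn

/-- **`stub_chromaticDivisibility` (verbatim header) MODULO the two Λ-free corank-zero inputs.**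
Granted GZK (`hGZK`), `hasEntireLFunction_rat` (`hmod`, `r_an = 0 ⇔ L(E,1) ≠ 0`) and the period-ratio unit
at `3` (`hper`) — all PUBLISHED named facts of the support item — and DISPLAYED as explicit binders the two
OPEN Λ-free inputs (conv₀) «X8 ∧ `Sel_{3^∞}(E/ℚ)` finite ⇒ `r_an = 0`» and (low₀) «X8 ∧ `r_an = 0` ⇒
`ord_3 #Ш_an ≤ ord_3 #Ш`», the registered stub (B) holds for EVERY X8 pair and its real objects, for the
colour `♭` (either works: `c_♭ ∈ {−1, 5}`, `c_♯ ∈ {−1, −13}` are `3`-adic units). By cases on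
`Finite Sel_{3^∞}(E/ℚ)`: infinite ⇒ `ξ = h = 0`; finite ⇒ `chromaticDatum_of_missingLowerBoundAt`.
So crux 5's divisibility clause needs NO Λ-adic engine beyond (conv₀) ∧ (low₀). CONDITIONAL; closes
nothing; (conv₀), (low₀) are OPEN class-wide and NOT claimed.
[cite: Sprung2017, Cor. 4.11 (table of special values)] [cite: Sprung2012, Main Conj. 1.3 and Prop. 7.19]
[cite: GreenbergVatsal2000, §3 Remark 3.4] [cite: Miller2011LMS, Def. 1.1] -/
theorem stub_chromaticDivisibility_of_corankZero_inputs
    (hGZK : rank_eq_analyticRank_of_analyticRank_le_one) (hmod : hasEntireLFunction_rat)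
    (hper : realPeriodRat_eq_unit_mul_plusPeriod_three)
    (hconv : ∀ (W : WeierstrassCurve ℚ) [W.IsElliptic] [W.IsGloballyMinimal],
      ClassX8 W 3 → Finite (W.selmerGroupPInfty 3) → W.analyticRank = 0)
    (hlow : ∀ (W : WeierstrassCurve ℚ) [W.IsElliptic] [W.IsGloballyMinimal],
      ClassX8 W 3 → W.analyticRank = 0 → MissingLowerBoundAt W 3) :
    ∀ (W : WeierstrassCurve ℚ) [W.IsElliptic] [W.IsGloballyMinimal] (p : ℕ) [Fact p.Prime],
      Literature.NumberTheory.EllipticCurves.Rank1Residual.ClassX8 W p →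
      ∀ (N : ℕ) (_ : NeZero N) (f : CuspForm (CongruenceSubgroup.Gamma0 N) 2) (ϖ : ℚ)
        (Lsharp Lflat : Literature.NumberTheory.EllipticCurves.IwasawaAlgebra p),
        Literature.NumberTheory.EllipticCurves.ModularForms.IsNewformOf W f →
        (ϖ : ℝ) * W.realPeriodRat = Literature.NumberTheory.EllipticCurves.ModularForms.plusPeriod f →
        Literature.NumberTheory.EllipticCurves.Sprung2017.IsSprungPair f p (W.frobeniusTrace p)
          Lsharp Lflat →
        ∃ (c : Literature.NumberTheory.EllipticCurves.Sprung2017.Chroma)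
          (ξ : Literature.NumberTheory.EllipticCurves.IwasawaAlgebra p),
          (⟨ξ, 0, 0⟩ : Summit.BirchSwinnertonDyer.Rank1Residual.Supersingular.SignedDatum W p).EulerCharacteristic ∧
          ∃ h : Literature.NumberTheory.EllipticCurves.IwasawaAlgebra p,
            Literature.NumberTheory.EllipticCurves.iwasawaToPowerSeries p ξ =
              PowerSeries.C (ϖ : ℚ_[p]) *
                Literature.NumberTheory.EllipticCurves.iwasawaToPowerSeries p
                  (Literature.NumberTheory.EllipticCurves.Sprung2017.chromaticL c Lsharp Lflat * h) := by
  intro W _ _ p _ hX N hN f ϖ Lsharp Lflat hf hϖ hSP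
  have hp3 : p = 3 := hX.1
  subst hp3
  by_cases hfin : Finite (W.selmerGroupPInfty 3)
  · have hr : W.analyticRank = 0 := hconv W hX hfin
    have hL : W.entireLFunction 1 ≠ 0 := (W.analyticRank_eq_zero_iff_holds (hmod W)).1 hr
    have hϖ1 : ‖(ϖ : ℚ_[3])‖ ≤ 1 := (X8_norm_periodRatio_eq_one hper W 3 hX hf hϖ).le
    obtain ⟨ξ, hK, hdiv⟩ := chromaticDatum_of_missingLowerBoundAt W 3 hGZK (by decide) hX.2.1.1
      (ClassX8.irr W 3 hX) hL hf hϖ hϖ1 hSP .flat (ClassX8.not_dvd_chromaticConst' W 3 hX .flat)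
      (hlow W hX hr)
    exact ⟨.flat, ξ, hK, hdiv⟩
  · obtain ⟨ξ, hK, hdiv⟩ := chromaticDatum_of_not_finite_selmer W 3 hfin ϖ (chromaticL .flat Lsharp Lflat)
    exact ⟨.flat, ξ, hK, hdiv⟩

/-- **Conversely, the registered stub (B) GIVES BACK the two Λ-free inputs**, once the real objects of
stub (A) exist (here supplied by modularity `hmodE : exists_isNewformOf`, the period fact `hper`, and
Sprung's theorem `thm112_exists_isSprungPair_holds`): for every X8 pair with `Sel_{3^∞}(E/ℚ)` finite,
`L(E,1) ≠ 0` (so `r_an = 0`) and `MissingLowerBoundAt W 3`. With the previous theorem: crux 5's clause (B)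
is EXACTLY (conv₀) ∧ (low₀) modulo the published facts — the kernel form of the planner's tenure note
(«crux 5 pins `ξ` only through (K•)'s constant term»). CONDITIONAL; closes nothing.
[cite: Sprung2017, Thm. 1.12 and Cor. 4.11] [cite: DiamondShurman2005, Thm. 8.8.3]
[cite: GreenbergVatsal2000, §3 Remark 3.4] [cite: Miller2011LMS, Def. 1.1] -/
theorem corankZero_inputs_of_stub_chromaticDivisibility
    (hGZK : rank_eq_analyticRank_of_analyticRank_le_one) (hmodE : exists_isNewformOf)
    (hper : realPeriodRat_eq_unit_mul_plusPeriod_three)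
    (hB : ∀ (W : WeierstrassCurve ℚ) [W.IsElliptic] [W.IsGloballyMinimal] (p : ℕ) [Fact p.Prime],
      ClassX8 W p →
      ∀ (N : ℕ) (_ : NeZero N) (f : CuspForm (Gamma0 N) 2) (ϖ : ℚ) (Lsharp Lflat : IwasawaAlgebra p),
        IsNewformOf W f → (ϖ : ℝ) * W.realPeriodRat = plusPeriod f →
        IsSprungPair f p (W.frobeniusTrace p) Lsharp Lflat →
        ∃ (c : Chroma) (ξ : IwasawaAlgebra p), (⟨ξ, 0, 0⟩ : SignedDatum W p).EulerCharacteristic ∧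
          ∃ h : IwasawaAlgebra p, iwasawaToPowerSeries p ξ =
            PowerSeries.C (ϖ : ℚ_[p]) * iwasawaToPowerSeries p (chromaticL c Lsharp Lflat * h))
    (W : WeierstrassCurve ℚ) [W.IsElliptic] [W.IsGloballyMinimal] (hX : ClassX8 W 3)
    (hfin : Finite (W.selmerGroupPInfty 3)) :
    W.entireLFunction 1 ≠ 0 ∧ MissingLowerBoundAt W 3 := by
  haveI hN : NeZero (W.conductorNorm ℤ) := ⟨(W.conductorNorm_pos_holds).ne'⟩
  obtain ⟨f, hf⟩ := hmodE W
  have hgood : W.HasGoodReductionAtPrime 3 := hX.2.1.1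
  have hirr : W.HasIrreducibleModPGaloisRep 3 := ClassX8.irr W 3 hX
  obtain ⟨u, hu1, hΩ⟩ := hper W hgood hirr f hf
  have hu0 : u ≠ 0 := by
    intro h0
    rw [h0, Rat.cast_zero, norm_zero] at hu1
    exact zero_ne_one hu1
  have hϖ : ((u⁻¹ : ℚ) : ℝ) * W.realPeriodRat = plusPeriod f := by
    rw [hΩ, Rat.cast_inv, ← mul_assoc, inv_mul_cancel₀ (Rat.cast_ne_zero.mpr hu0), one_mul]
  obtain ⟨Lsharp, Lflat, hSP⟩ :=
    thm112_exists_isSprungPair_holds (W := W) (f := f) (p := 3) (by decide) hf hgood hX.2.1.2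
  obtain ⟨c, ξ, hK, hdiv⟩ := hB W 3 hX (W.conductorNorm ℤ) hN f u⁻¹ Lsharp Lflat hf hϖ hSP
  exact entireLFunction_one_ne_zero_and_missingLowerBoundAt_of_chromaticDatum W 3 hGZK (by decide)
    hgood hirr hf hϖ hSP c (ClassX8.not_dvd_chromaticConst' W 3 hX c) hfin ξ hK hdiv

end X8

end Summit.BirchSwinnertonDyer.BirchSwinnertonDyer.Theorems

end
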